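import Mathlib
import HarnessLib
import HarnessLib.Audit
import Summits.Parity.Statement
import Summits.Parity.BatemanHorn.Theorems.IsogenyRedeiTypeIMainTerm
import Summits.Parity.BatemanHorn.Theorems.IsogenyRedeiLambdaToCount
import HarnessLib.Audit.Status.Attr

/-!
Route: CyclotomicTower

DORMANT since 2026-08-24T17:57:51Z (reconciler: no traction for 6.9 d (last activity item-evidence-added at 2026-08-17T18:31:59Z); parked, not closed — `ledger route dormant route-Parity-CyclotomicTower --off` to reactivate) — unstaffed, not closed; items shared with open routes are served there. `ledger route dormant <id> --off` reactivates.

# Route CyclotomicTower — ζ₈ is quadratic over ℚ(√2): DFI Type I/II for the roots of n⁴+1 feeding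
the prime slice of the Möbius-tail frame for BatemanHorn

Conforming re-filing of route QuarticRoots (retired 2026-08-15 `not-a-thesis`: its assembly stopped
at the intermediate statement QuarticRootsPrimeModuli), realising card cyclotomic-roots-hilbert-dfi
(spine). It suffices to show X = X_PM, the MÖBIUS-TAIL frame of route PolynomialMobius, re-wanted
here verbatim (target PolyMobiusTail = stmt-Parity-0870; theorem-grade glue TypeIMainTerm,
LambdaToCount, MobiusFrame = 0873/0874/0875): for every Bateman–Horn system f there is η ∈ (0,1)
with Σ_{n≤x} Σ_{d_i ∣ f_i(n), d₁⋯d_k > x^{1−η}} ∏ μ(d_i) log d_i = o(x); the deciding theorem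
`closes : PolyMobiusTail → TypeIMainTerm → LambdaToCount → BatemanHorn` is PROVED in this file
(rev 1, 2026-08-15: the genuine Λ = −(μ·log) ∗ 1 bookkeeping, the same term as
PolynomialMobius.closes — no longer a pass-through taking MobiusFrame as a hypothesis). This route
exists for ONE slice of X, the first beyond degree 3 with usable structure: k = 1, f = X⁴+1,
PRIME moduli d = p ∈ (x^{1−η}, x^{1+δ}], where μ(d) = −1 is constant, so the slice is an UNSIGNED
Type-I quantity beyond level x — exactly what the card's engine proposes to supply: ζ₈ is
quadratic over F = ℚ(√2), so (n, ν mod n) ↔ (primitive ideal 𝔫 ⊂ ℤ[√2] of norm n, root A of the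
CM relative quadratic Y² − √2·Y + 1 mod 𝔫), and Duke–Friedlander–Iwaniec's parametrisation /
reciprocity / Kloosterman–Kuznetsov machinery is run over F. Its deliverables are the ranked
cruxes, in DFI's own architecture transposed to X⁴+1 for the Weyl sums
ρ_h(n) = Σ_{ν⁴≡−1 (n)} e(hν/n): QuarticTypeI (2: linear forms along multiples, level x^{1/2−ε},
power saving), QuarticTypeII (3: balanced bilinear forms, power saving), QuarticPrimeWindow (4:
prime moduli p ∈ [X, X^{1+δ}] in the narrow window ℓ ≤ X — the slice itself at its lower end),
QuarticRootsPrimeModuli (5: roots of X⁴+1 equidistributed modulo primes, = 2 ∧ 3 via Vaughan,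
support DFIReduction). Honest status: the quartic cruxes are INPUTS to the X⁴+1 slice of X (prose
link, §Assembly), not a decomposition of X; `closes` does not use them.
Lean: `∀ (k : ℕ) (f : Fin k → Polynomial ℤ), Literature.NumberTheory.Sieve.IsBatemanHornSystem f → ∃
η : ℝ, 0 < η ∧ η < 1 ∧ (fun x : ℕ => ∑ n ∈ Finset.Icc 1 x, ∑ d ∈ Fintype.piFinset (fun i => (((f
i).eval (n : ℤ)).toNat).divisors), if (x : ℝ) ^ (1 - η) < ∏ i, (d i : ℝ) then ∏ i,
((ArithmeticFunction.moebius (d i) : ℝ) * Real.log (d i)) else 0) =o[Filter.atTop] fun x : ℕ => (x :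
ℝ)`

## Assembly
The deciding theorem (rev 1) is `closes (hTail : PolyMobiusTail) (hMain : TypeIMainTerm)
(hCount : LambdaToCount) : _root_.BatemanHorn`, proved in the file: per coordinate
∏ Λ(f_i(n)) = (−1)^k Σ_{d ∈ ∏ divisors(f_i(n))} ∏ μ(d_i) log d_i (Mathlib
ArithmeticFunction.sum_moebius_mul_log_eq, Finset.prod_univ_sum), the divisor sum split at
∏ d_i ≤ x^{1−η} (TypeIMainTerm: ∼ C·x) versus > x^{1−η} (PolyMobiusTail: o(x)),
IsEquivalent.add_isLittleO, then LambdaToCount. Its hypotheses are three of the route's items and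
nothing else; the support item MobiusFrame (0875, shared with PolynomialMobius) is literally this
implication and the Assembly item is a weakening of it (extra unused premises) — both provable now
by `closes`. IMPORT CONE (route-repair 2026-08-15): the route has no import beyond the gate
boilerplate and no Literature fact is a hypothesis of any item; the only closed named fact in the
used-constants cone is BatemanHornConjecture itself, reached through the conclusion
_root_.BatemanHorn (target side); HardyLittlewoodConjE and the three Green–Tao statements of
LinearEquationsInPrimes ride in only on the imports of Summits.Parity.Statement and are used by
no decl. How the cruxes bear on the frame (prose, the honest link): for k = 1, f = X⁴+1 the tail
is Σ_{n≤x} Σ_{d ∣ n⁴+1, d > x^{1−η}} μ(d) log d; its prime-modulus part d = p is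
−Σ_{x^{1−η} < p} log p · #{n ≤ x : p ∣ n⁴+1}, an UNSIGNED sum that QuarticPrimeWindow evaluates
asymptotically on (X, X^{1+δ}] and QuarticRootsPrimeModuli/QuarticTypeI control at fixed and at
level-1/2 scales; the composite-modulus (signed) and cofactor parts stay with PolynomialMobius
(its cruxes PolyMobiusAtom / PolyChowla).

Rationale: WHY THIS LINE. The only prime-modulus equidistribution theorem for roots of polynomial congruences
is DukeFriedlanderIwaniec1995
(deg 2, o(π(x)); Toth2000 all quadratics): Gauss correspondence (n = r²+s², ν = s/r) +
Bykovskii/Poincaré series on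
Γ₀(d) ⇒ Prop. 1 (linear forms along multiples, level x^{1/2}); CRT twisting ⇒ Prop. 2 (bilinear
forms); sieve
Theorem S ⇒ primes (paper:url-c7638613861e pp.425–426, 435–438) — while for deg ≥ 3 even the density
of {ν/p} is
conditional on Bunyakovsky (Foo2010 = doi:10.4064/aa144-1-1 = arXiv:0906.1240), CubicRoots bets on
SL₃ dynamics for generic cubics, and for n⁴+1 the
resultant/geometry-of-numbers method reaches only P⁺(n⁴+1) ≥ X^{1+c} on a positive density of n, its
authors asking
for 'résultats d'équirépartition efficace pour des formes de degré 4' (Delabreteche2015 =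
doi:10.4064/aa169-3-2, Thm 1.2 and Rem. 2).
The card's move: for the 2-power cyclotomic/dihedral quartics the Gauss correspondence survives one
level up —
ζ₈ is quadratic over F = ℚ(√2) (h_F = h_{ℚ(ζ₈)} = 1), roots of X⁴+1 mod n ↔ roots of g = Y² − √2Y +
1 modulo
primitive ideals 𝔫 = (α² + √2αβ + β²) ⊂ ℤ[√2] (support TowerSplitting at primes), with an
𝒪_F-reciprocity
A/n̂ ≡ ūᾱ/β − α/(βn̂) (mod 𝒪_F) of exactly DFI's shape; imported area = GL₂ spectral theory over a
real
quadratic field (Kuznetsov for Γ₀(𝔮) ⊂ SL₂(ℤ[√2]): Bruggeman–Miatello; Weil over ℤ[√2]/𝔟;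
exceptional spectrum
θ = 7/64 over number fields: Blomer–Brumley arXiv:1003.0559), Bianchi groups over ℚ(√∓2) for X⁴ ± 2.
What the route adds to the card after reading DFI 1995: (a) the typed architecture X_I ∧ X_II ⇒ T by
Vaughan, so
each half is refutable on its own and the glue is a theorem; (b) recalibration — even in degree 2
the saving over
PRIME moduli is only logarithmic ('by no means could we do better', DFI p.425), so power savings are
asked only of
the Type I/II inputs; (c) the precise obstruction the engine must beat, recorded as QuarticTypeI's
why-it-might-fail
and as the structural cheapest falsifier: the rational phase e(hν/n), ν ∈ ℤ, is the Hilbert-modular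
phase
e(tr(ηA/n̂)) only at an 𝔫-DEPENDENT frequency η ≡ h·(tr n̂)⁻¹ (mod 𝔫) of size ≍ √n (ℤ ⊂ ℤ[√2]/𝔫 is a
half-dimensional slice; RootReciprocity is its coordinate shadow: modulus d ≍ √p, error O(p^{−1/2})
instead of
DFI's O(1/p)). Disjoint in mechanism and polynomial class from QuadraticRoots/UnimodularColumns (deg
2, GL₂/ℚ),
CubicRoots (deg 3, SL₃), PolynomialMobius (all f, no engine); negatives index empty.
Why the Möbius-tail frame: under D-0027 §2.1 a BatemanHorn route must decide _root_.BatemanHorn; the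
only typed reduction of
the conjunct is PolynomialMobius' Λ = −(μ·log) ∗ 1 split (Type-I main term + tail), whose tail for
one f of degree g lives
on divisors d ∈ (x^{1−η}, x^{g−1+η}] of f(n); its prime-modulus part is unsigned and is fed, for g =
4 and f = X⁴+1, by cruxes
4–5 (and, one layer down, 2–3) — the same position CubicRoots' 0878/0879 held for g = 3 before that
route was retired with
the legacy assemblies.

RANKED CRUXES. #0 PolyMobiusTail (target) — X_PM of route PolynomialMobius (stmt-Parity-0870),
re-wanted verbatim as this route's frame: for every Bateman–Horn system f = (f₁,…,f_k) there is η ∈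
(0,1) with Σ_{n≤x} Σ_{d_i ∣ f_i(n), d₁⋯d_k > x^{1−η}} ∏_i μ(d_i) log d_i = o(x). With TypeIMainTerm
and LambdaToCount it gives _root_.BatemanHorn (MobiusFrame). This route attacks its k = 1, f = X⁴+1,
prime-modulus slice. (why it might fail: = BatemanHorn in Λ-form modulo the theorem-grade glue
(Bombieri's indeterminacy: no Type-I level < 1 decides it); false iff BH fails for some system —
which happens verbatim over 𝔽_q[u] for inseparable f (Conrad–Conrad–Gross).)
[BombieriAsymptoticSieve1976, arXiv:2008.09905, Literature.Barriers.Parity.FunctionFieldMobiusBias,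
Literature.Barriers.Parity.FordFixedLevelBarrier]
#2 QuarticTypeI (crux) — DFI Proposition 1 transposed to X⁴+1 (the Type-I half of X): for every h ≠
0 and ε > 0 there are δ, C > 0 such that for x ≥ 2 and every cut-off function y with y(d) ≤ x/d:
Σ_{d ≤ x^{1/2−ε}} |Σ_{m ≤ y(d)} ρ_h(dm)| ≤ C x^{1−δ}, ρ_h(n) = Σ_{ν mod n, ν⁴≡−1} e(hν/n) —
power-saving equidistribution of the roots of X⁴+1 modulo n ≡ 0 (mod d) at level x^{1/2−ε} (trivial
≍ x, heuristic x^{3/4}; numerics j000079 (C): T(x) ≈ x^{0.59} for x ≤ 10⁶). The engine's first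
deliverable: over F the sum runs over primitive ideals 𝔫 ≡ 0 (mod 𝔮) of ℤ[√2] and roots of Y² − √2Y
+ 1. [difficulty: open-problem] (why it might fail: Hooley1964 saves only (log x)^-δ for deg ≥ 3, no
level; e(hν/n) is a Hilbert-modular phase over ℚ(√2) only at an 𝔫-dependent frequency ≍ √n (ν ∈ ℤ is
a half-dimensional slice of ℤ[√2]/𝔫): Kuznetsov over F would need uniformity in frequencies up to
√(modulus).) [DukeFriedlanderIwaniec1995, Hooley1964, doi:10.1093/imrn/rnr112, arXiv:2505.00493,
HeathBrown2001LargestPrimeFactorCubic, arXiv:1003.0559]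
#3 QuarticTypeII (crux) — DFI Proposition 2 transposed to X⁴+1, in the balanced range (the Type-II
half of X): for every h ≠ 0 and δ > 0 there are η, C > 0 such that for 1 ≤ N, M^δ ≤ N ≤ M and all
1-bounded coefficients α, β: |Σ_{M<m≤2M} Σ_{N<n≤2N} α_m β_n ρ_h(mn)| ≤ C (MN)^{1−η}. By CRT ρ_h(mn)
= Σ_{ν₁,ν₂} e(hν₁n̄/m) e(hν₂m̄/n) for (m,n) = 1: bilinear forms with root-weighted Kloosterman
fractions; DFI 1995 p.425 call ‖α‖‖β‖(M+N)^{1/2}(hMN)^ε 'plausible' and prove a shorter range with β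
on primes. [deps: QuarticTypeI] [difficulty: open-problem] (why it might fail: Even for n²+1 a power
saving in the balanced range N ≈ M is not in print (DFI 1995 Prop. 2: short N, β on primes; GM 2025
Thm 1.5: N ≤ X^1/4); the CRT reduction needs QuarticTypeI uniform in d ≤ x^(1−ε) and in twisted
frequencies h(n₂−n₁) ≤ x.) [DukeFriedlanderIwaniec1995, arXiv:2505.00493, arXiv:1502.00769,
KowalskiSoundararajan2021]
#4 QuarticPrimeWindow (crux) — card C2/C4, the consumable rung: there are δ, C > 0 such that for 2 ≤
X ≤ P ≤ X^{1+δ}: |Σ_{P<p≤2P prime} (#{1 ≤ ℓ ≤ X : p ∣ ℓ⁴+1} − X·ϱ(p)/p)| ≤ C X^{1−δ}, ϱ(p) = #{ν mod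
p : ν⁴ ≡ −1} (main term ≍ X/log X, fluctuation heuristic √X; numerics j000079 (B): within 2√main up
to P = X^{1.5}, X ≤ 10⁵). Equidistribution of ν/p at the shrinking scale X/P over PRIME moduli just
beyond X: the prime slice d = p ∈ (x, x^{1+δ}] of the Möbius tail of n⁴+1 (μ(p) = −1 constant ⇒
unsigned) and the Dickman-type law for P⁺(n⁴+1) near exponent 1. [deps: QuarticTypeI, QuarticTypeII]
[difficulty: open-problem] (why it might fail: Needs Weyl sums uniform in h ≤ P/X ≈ X^δ, where the
reciprocity error O(h·p^-1/2) bites, plus Type II to reach primes; for n⁴+1 only geometry of numbers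
goes beyond X (P⁺ ≥ X^(1+c) on a positive density, Delabreteche2015 Thm 1.2; Φ₁₂: c = 10^-26531) —
never prime moduli.) [doi:10.4064/aa169-3-2, arXiv:2505.00493,
HeathBrown2001LargestPrimeFactorCubic, DeshouillersIwaniec1982, MarklofWelsh2023]
#5 QuarticRootsPrimeModuli (crux) — card C1, the landmark (implied by QuarticTypeI ∧ QuarticTypeII
via VaughanGlue — support DFIReduction): for every integer h ≠ 0, Σ_{p ≤ P prime} Σ_{ν mod p, ν⁴ ≡
−1} e(hν/p) = o(P/log P) (Weyl's criterion for the pairs (p, ν), whose number is ∼ π(P)). Degree-4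
instance of DFI 1995; the prime-modulus input for d = p > x in the X⁴+1 slice of the frame. [deps:
QuarticTypeI, QuarticTypeII] [difficulty: open-problem] (why it might fail: DFI 1995 p.425: 'the
problem for polynomials of higher degree seems to us to be very far away'; for deg ≥ 3 even the
density of {ν/p} is known only under Bunyakovsky (Foo2010); = the Kowalski–Soundararajan
prime-moduli conjecture at f = X⁴+1.) [DukeFriedlanderIwaniec1995, doi:10.4064/aa144-1-1,
arXiv:2003.12965, Hooley1964, Toth2000]
#9 TypeIMainTerm (support) — shared verbatim with PolynomialMobius (stmt-Parity-0873): the Type-I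
main term — for every BH system f and η ∈ (0,1) there is C > 0 with HasBatemanHornConst f C and
(−1)^k Σ_{n≤x} Σ_{d_i ∣ f_i(n), ∏d_i ≤ x^{1−η}} ∏ μ(d_i) log d_i ∼ C·x (elementary count with period
lcm(d) ≤ x^{1−η} + log-weighted singular series → C(f) by the prime ideal theorem). Theorem-grade,
provable with effort. [difficulty: L] [BatemanHorn1962, BombieriAsymptoticSieve1976]
#9 LambdaToCount (support) — shared verbatim with PolynomialMobius (stmt-Parity-0874): from Σ_{n≤x}
∏Λ(f_i(n)) ∼ C·x with HasBatemanHornConst f C to BatemanHornAsymptotic f (partial summation; proper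
prime-power values negligible). Theorem-grade. [difficulty: L] [BatemanHorn1962,
IwaniecKowalski2004]
#9 MobiusFrame (support) — shared verbatim with PolynomialMobius' assembly (stmt-Parity-0875):
PolyMobiusTail → TypeIMainTerm → LambdaToCount → _root_.BatemanHorn (Λ = −(μ·log) ∗ 1 per
coordinate, split at ∏ d_i ≤ x^{1−η}, IsEquivalent.add_isLittleO, then LambdaToCount). Provable now
(bookkeeping); it is the body of this route's `closes`. [difficulty: M]
[BombieriAsymptoticSieve1976, BatemanHorn1962]
#9 VaughanGlue (support) — sequence-agnostic glue (known method, provable with effort): for c : ℕ →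
ℂ with |c(n)| ≤ τ(n)², Type I at level x^{1/2−ε} with a power saving (sup-over-length form) and Type
II with a power saving whenever M^δ ≤ N ≤ M imply Σ_{p≤P} c(p) = o(P/log P). Proof: Vaughan's
identity with U = V = P^{δ₀} (in tree: Literature.NumberTheory.Sieve.VaughanMeanValueDecomposition,
vonMangoldt_eq_four_terms), Type I pieces by partial summation (level P^{2δ₀} ≤ P^{1/2−ε}), Type II
pieces after dyadic decomposition and Perron separation of mn ≤ P (twists m^{it}, n^{it} keep
coefficients 1-bounded), τ-bounds ≤ P^ε against the power saving, prime powers trivially, partial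
summation from Λ to primes. [difficulty: L] [Vaughan1980, IwaniecKowalski2004,
DukeFriedlanderIwaniec1995]
#9 TowerSplitting (support) — the dictionary lemma at primes: in 𝔽_p with s² = 2, ν⁴ + 1 = 0 ↔ (ν² −
sν + 1 = 0 ∨ ν² + sν + 1 = 0), from X⁴+1 = (X² − sX + 1)(X² + sX + 1); i.e. the roots of X⁴+1 mod p
≡ ±1 (8) are the roots of the CM relative quadratic g = Y² − √2·Y + 1 of ℚ(ζ₈)/ℚ(√2) read at the two
degree-one primes of ℤ[√2] above p (√2 ↦ ±s). Provable now (ring identity + no zero divisors).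
[difficulty: provable-now] [doi:10.4064/aa169-3-2, Toth2000]
#9 RootReciprocity (support) — the card's reciprocity step as an exact identity: for ε = ±1, p =
ε(c² − 2d²) > 0, d ≠ 0, gcd(c, d) = 1, p ∣ dν − (dA₀ − cA₁) (i.e. ν ≡ A₀ + A₁√2 with √2 ≡ −c/d mod
p) and c·c̄ ≡ 1 (mod d): ν/p ≡ A₀/p + ε·A₁·c̄/d − A₁c/(dp) (mod 1). With c + d√2 in a fixed
fundamental domain for the unit 1+√2 (|c|, |d| ≍ √p) and a short representative |Aᵢ| ≪ √p this is
ν/p = εA₁c̄/d + O(p^{−1/2}): a Kloosterman fraction of modulus d ≍ √p (DFI, n²+1: ν/p = −s̄/r +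
O(1/p)). Checked numerically in-session (p = 17 = 5²−2·2², ν = 8, A = 2+√2; p = 7, ε = −1). Provable
now (two-term reciprocity d̄/p + p̄/d ≡ 1/(dp), p ≡ εc² mod d). [difficulty: provable-now]
[DukeFriedlanderIwaniec1995, Toth2000]
#9 DFIReduction (support) — the DFI architecture as a provable implication (the retired route's
assembly): QuarticTypeI → QuarticTypeII → VaughanGlue → QuarticRootsPrimeModuli — fix h ≠ 0 and
apply VaughanGlue to c := ρ_h, using |ρ_h(n)| ≤ ϱ(n) ≤ 4^{ω(n)} ≤ τ(n)² (X⁴+1 has ≤ 4 simple roots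
mod p^a for odd p, ϱ(2) = 1, ϱ(4) = 0) and the cast ((d·m : ℕ) : ℂ) = d·m. Provable now.
[difficulty: provable-now] [DukeFriedlanderIwaniec1995, Vaughan1980]

TWO-LAYER PLAN. Foreseen glued splits (none filed now; k ≤ 3, depth 1). QuarticTypeI ⇐ (F-TypeI:
power-saving sums of the F-Weyl
sums Σ_{A mod 𝔫, g(A)≡0} e(tr(ηA/n̂)) over primitive ideals 𝔫 ≡ 0 (mod 𝔮) of ℤ[√2], UNIFORM in
F-frequencies
|η| ≤ (N𝔫)^{1/2+ε} — Kuznetsov over ℚ(√2) + Weil over ℤ[√2]/𝔟 + θ = 7/64) → (Bridge: e(hν/n) =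
e(tr(η_𝔫 A/n̂)) with
η_𝔫 ≡ h(tr n̂)⁻¹ (mod 𝔫); RootReciprocity is its coordinate form) → QuarticTypeI. QuarticTypeII ⇐
(CRT twist, DFI 1995
§5) → (QuarticTypeI uniform in d ≤ x^{1−ε} and |h| ≤ x) → QuarticTypeII. QuarticPrimeWindow ⇐
(narrow-window Type I
over ALL moduli: Σ_{d≤X^δ} |Σ_{k∼K, d∣k} (A_k(X) − ϱ(k)X/k)| ≤ X^{1−δ} for K ≤ X^{1+δ} — also the
Chebyshev input,
giving P⁺(n⁴+1) > X^{1+δ'} with a visible δ', and reachable as well by the geometry-of-numbers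
variant on the factored
norm form N_{ℚ(ζ₈)/ℚ} = N_{F/ℚ} ∘ N_{K/F}) → (narrow-window Type II) → QuarticPrimeWindow (Harman /
DFI Theorem S sieve).

KILL CRITERIA. PolyMobiusTail refuted (some BH system with a biased Möbius tail) while TypeIMainTerm
∧ LambdaToCount are proved ⇒ ¬BatemanHorn: file it (shared
kill with PolynomialMobius). QuarticRootsPrimeModuli refuted (a provable bias of ν/p for ν⁴ ≡ −1
over primes, or |S_h(P)|/π(P) not decaying
numerically — j000079/j000172: square-root cancellation to 3·10⁸) closes the route
`refuted:QuarticRootsPrimeModuli` (the engine has no output left) (and, read through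
Foo2010, is evidence against Bunyakovsky for n⁴+1 — report it loudly). QuarticTypeI refuted
(Ω(x^{1−ε}) for some h)
kills the engine and QuarticTypeII's CRT reduction: close. QuarticTypeII refuted alone: pivot —
restate with β
supported on primes and N ≤ x^{1/3} and replace VaughanGlue by DFI's Theorem S. ENGINE kill without
refuting an
item: a refuter shows the √n-frequency obstruction (QuarticTypeI, why it might fail) cannot be met
by any
Kuznetsov-over-F argument (no gain over a generic S₄ quartic) AND the geometry-of-numbers variant
gives no visible
δ — close `exhausted` with that census. Mooted if CubicRoots-type dynamics or the
Kowalski–Soundararajan prime-moduli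
conjecture is proved for all f (close superseded).

NOT DECOMPOSED YET. The F-side facts (Kuznetsov/Bruggeman–Miatello for Γ₀(𝔮) ⊂ SL₂(ℤ[√2]), Weil
bound over ℤ[√2]/𝔟, Blomer–Brumley
θ = 7/64) are NOT filed as cite items until the bridge child of QuarticTypeI is typed — they are the
engine, not
hypotheses of any item, so the route's import cone has no unproved fact. Also left for later:
h-uniformity; the
siblings Φ₅, Φ₁₂, X⁴ ± 2 (same engine over ℚ(√5), ℚ(√3), ℚ(√∓2)); composite moduli in the window;
everything signed
(μ-twisted) — PolynomialMobius/CubicRoots territory; BatemanHorn for n⁴+1 itself. The frame X itself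
is NOT decomposed here (that is PolynomialMobius' business); a
typed window decomposition of the X⁴+1 tail (prime slice / composite signed slice / cofactor side,
with cancelling x log x
main terms) is the tenure-level split that would make cruxes 4–5 formal children of X.

CHEAPEST FALSIFIER. (i) Numerics, kit jobs j000079/j000172 (done): Weyl sums S_h(P) = Σ_{p≤P}
ρ_h(p), h ≤ 6 — at P = 3·10⁸
(N = 16248220 pairs): |S_h|/√N ∈ [0.01, 1.62], |S_h|/N ≤ 0.04 %, star discrepancy of {ν/p} ≤ 0.00025
(10⁵: 0.0085, 10⁶: 0.0027,
10⁷: 0.0012, 10⁸: 0.0004 — ∼ N^{−1/2}); window counts (B): all 16 cells X ∈ {10³,10⁴,3·10⁴,10⁵}, P =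
X^t, t ≤ 1.5 (P ≤ 3.2·10⁷) within
2.0·√main of X·Σϱ(p)/p; Type-I sums (C): T(x) = Σ_{d≤√x}|Σ_{m≤x/d} ρ₁(dm)| = 97, 687, 1461, 3605 at
x = 10⁴, 10⁵, 3·10⁵,
10⁶ (≈ x^{0.59} vs trivial 0.50x…0.62x). A non-decaying |S_h|/N kills the target, a T(x)/x plateau
kills QuarticTypeI,
a drifting window cell kills QuarticPrimeWindow. (ii) One-hour structural check: e(hν/n), ν ∈ ℤ, is
the Hilbert-modular
phase e(tr(ηA/n̂)) only for η ≡ h(tr n̂)⁻¹ (mod 𝔫), |η| ≍ √n; can DFI-2011-type uniformity (DFI 2011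
= doi:10.1093/imrn/rnr112, Thm 1.1: h^{3/4}D^{−1/1331})
ever cover η ≍ √(modulus)? If provably not, the automorphic engine is void and only the
geometry-of-numbers variant
of the two-layer plan remains.

NUMBERS. deg 2: Σ_{p≤x} ρ_h(p) = o(π(x)), at best O(π(x)(log log x)^B/log x) (DFI 1995 p.425);
P⁺(n²+h) > n^{1.312}, window
Type I for D ≤ X^{1/2}, Type II for N ≤ X^{1/4} (arXiv:2505.00493 Thms 1.1, 1.4, 1.5); Σ_{n≤x}
ρ_h(n) ≪ x^{3/4} (Hooley 1963)
→ x^{2/3} (Bykovskii). deg ≥ 3: (log x)^{−δ_f} over all moduli (Hooley1964); prime moduli: density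
only under
Bunyakovsky (Foo2010). n⁴+1 beyond x: positive density of n ≤ X with P⁺(n⁴+1) ≥ X^{1+c_Φ}
(Delabreteche2015 Thm 1.2,
c_Φ > 0 unspecified; Φ₁₂: c = 10^{−26531}, Dartyge 2015 = Delabreteche2015 Thm 1.1; n³+2: level
X^{1+10^{−303}},
HeathBrown2001LargestPrimeFactorCubic); needed for all quartics per Delabreteche–Mestre Rem. 2: Q₁ ≥
M^{2+ε}, Q₂ ≥ M^{1+ε}
in their Thm 3.11, proved only for Q₁Q₂ ≤ M^{3−ε}, Q₁+Q₂ ≤ M^{2−ε}. θ = 7/64 over every number field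
(Blomer–Brumley
2011). h(ℚ(√2)) = h(ℚ(ζ₈)) = 1; ϱ(p) = 4 for p ≡ 1 (8), 0 for other odd p, ϱ(2) = 1, ϱ(4) = 0. Items
at open: 13 (1 target, 4 cruxes, 7 support, 1 assembly); 4 of them (PolyMobiusTail, TypeIMainTerm,
LambdaToCount, MobiusFrame) shared verbatim with route-Parity-PolynomialMobius. Old: 8
.

DEFINITION REQUESTS. None. All items are elementary over Mathlib (Nat.primesLE, Finset sums,
Complex.exp, ZMod, Int.ModEq, IsCoprime);
no Literature fact is a hypothesis of any item. The F-side engine facts will be requested as `cite`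
items
(family parity) only when the bridge child of QuarticTypeI is typed in tenure.

Novelty: Searches (2026-08-15): `lit search "Duke Friedlander Iwaniec Weyl sums for quadratic roots"` (12
local — DFI 2011
held, arXiv:2105.02854, 2107.13301, 1502.00769, 2505.00489, 2505.00493 — + 14 remote,
zbMATH/Crossref only:
OpenAlex/S2/arXiv rate-limited this session); `lit search "equidistribution roots quadratic
congruence prime moduli"`
(15 local — DFI 1995 held as paper:url-c7638613861e, arXiv:2108.05496, Homma 2008
doi:10.1016/j.jnt.2007.09.003,
arXiv:2003.12965 — + 18 remote incl. Ngo 2024 doi:10.1112/blms.13108, Grimmelt–Merikoski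
arXiv:2505.00489);
zbMATH 'roots of quadratic congruences prime moduli discrepancy' (0); plus the card's audited
searches (zbMATH ×3,
galaxy: no 'DFI/Tóth over a number field', no prime-modulus result for any quartic). Read
in-session: DFI 1995
pp.423–427, 435–441; DFI 2011 pp.1–6; arXiv:2505.00493 pp.1–4; Delabreteche2015 pp.221–224 + refs.
Nearest prior art found: DukeFriedlanderIwaniec1995 (deg 2: Props 1–2 + Theorem S — the template
transposed here);
arXiv:2505.00493 (Grimmelt–Merikoski 2025: h-uniform deg-2 window Type I/II, P⁺(n²+h) > n^{1.312});
Delabreteche2015 with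
Dartyge 2015 (the same polynomials X⁴+1, Φ₁₂: V₄ structure via resultants + geometry of numbers, P⁺
only, effective
degree-4 equidistribution requested in Rem. 2); HeathBrown2001LargestPrimeFactorCubic / Hooley 1978
(norm-form
parametrisation for n³+2); KowalskiSoundararajan2021 (prime-moduli conjecture, CRT mixing);
arXiv:2108.05496
(residues of a fixed algebraic number mod  [refs: 10.1016/j.jnt.2007.09.003, 10.1112/blms.13108, 2105.02854, 2108.05496, 2003.12965, 2505.00489, 2505.00493, paper:url-c7638613861e, doi:10.1016/j.jnt.2007.09.003, doi:10.1112/blms.13108, DukeFriedlanderIwaniec1995, KowalskiSoundararajan2021]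

Barriers (technique_class: root-equidistribution kloosterman spectral hilbert-modular): - technique_class: root-equidistribution kloosterman spectral hilbert-modular
- Literature.Barriers.Parity.SelbergParityBarrier: APPLIES to the frame and is not evaded —
PolyMobiusTail is the whole parity content of BatemanHorn (Bombieri's indeterminacy), carried as the
target exactly as in PolynomialMobius; NOT engaged by the quartic items, which are UNSIGNED
statements about roots (ρ_h with h ≠ 0 has no main term; the window count is linear in 1_{p∣ℓ⁴+1});
VaughanGlue detects primes as MODULI of an oscillating sequence, where Vaughan + Type I/II is a
theorem, not a sieve lower bound; parity re-enters only in the continuation (μ-twisted composite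
moduli), explicitly left to PolynomialMobius.
- Literature.Barriers.Parity.FordMaynardLowLevel: applies to detecting prime VALUES n⁴+1 (thin set,
c = 3/4: Type-I level ≤ x of N = x⁴, no Type-II range); the route detects no prime values — it
supplies Type-I information at moduli BEYOND x (QuarticPrimeWindow, p ≤ x^{1+δ}), the catalogued
'specific structure' escape, and claims nothing about primes of the form n⁴+1.
- Literature.Barriers.Parity.FordMaynardMinimalTypeII: same scope remark — QuarticTypeII is bilinear
in the MODULUS mn of the root-counting function, not in a factorisation inside the value set, so the
barrier's normalisation does not apply; honest: it will apply to any later attempt to turn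
QuarticPrimeWindow into primes n⁴+1.
- Literature.Barriers.Parity.FordFixedLevelBarrier: not engaged (no asymptotic for primes is draw

History (route lifecycle, newest last):
- 2026-08-16T04:13:21Z · AUTO-CRUX (backfill): PolyMobiusTail — hypotheses of the deciding theorem that nothing in the route derives are cruxes (operator:999:1085951)
- 2026-08-24T17:57:51Z · DORMANT — reconciler: no traction for 6.9 d (last activity item-evidence-added at 2026-08-17T18:31:59Z); parked, not closed — `ledger route dormant route-Parity-Cyclotomi (operator:999:848516)

sub-problem: BatemanHorn · status: dormant · opened planner-plancard-Parity-BatemanHorn-cyclotomi-6fd1d998-0 2026-08-15T13:56:57Z · rev 1 · ledger route-Parity-CyclotomicTower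
GENERATED by the gate from the ledger (D-0016/17). Provers cite these decls: `theorem foo : Summit.Parity.BatemanHorn.Theses.CyclotomicTower.<Decl> := …` in Summits/Parity/BatemanHorn/Theorems/<Name>.lean.
-/

namespace Summit.Parity.BatemanHorn.Theses.CyclotomicTower

open scoped BigOperators Topology Manifold Classical MeasureTheory ProbabilityTheory Matrix InnerProductSpace ComplexConjugate ContinuousMap
open Filter Set Function TopologicalSpace MeasureTheory

attribute [summit_statement] _root_.BatemanHorn

/-- item stmt-Parity-0870 · crux (kind.auto-crux: conjecture-grade) · rank 0 · open · by planner
why it might fail: = BatemanHorn in Λ-form modulo the theorem-grade glue (Bombieri's indeterminacy: no Type-I level < 1 decides it); false iff BH fails for some system — which happens verbatim over 𝔽_q[u] for inseparable f (Conrad–Conrad–Gross).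
sources: BombieriAsymptoticSieve1976, arXiv:2008.09905, Literature.Barriers.Parity.FunctionFieldMobiusBias, Literature.Barriers.Parity.FordFixedLevelBarrier
[crux] X_PM, the Möbius tail: for every Bateman–Horn system f = (f_1..f_k) there is η ∈ (0,1) with
∑_{n≤x} ∑_{d_i | f_i(n), d_1⋯d_k > x^{1−η}} ∏_i μ(d_i) log d_i = o(x). Since ∏Λ(f_i(n)) = (−1)^k
∑_{d_i|f_i(n)} ∏ μ(d_i) log d_i and the complementary range d_1⋯d_k ≤ x^{1−η} is Type-I
(TypeIMainTerm), this is BatemanHorn minus theorem-grade glue. k = 1 reading: Möbius randomness of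
the large cofactor f(n)/e along the roots of f mod e, e ≤ x^{deg f − 1 + η}. Open (parity). Sources:
BombieriAsymptoticSieve1976 (indeterminacy), Entin2016 / SawinShusterman2018 (F_q[T] analogues are
theorems), BrowningSofosTeravainen2022 (true for 100% of f). -/
@[route_item "route-Parity-CyclotomicTower", crux]
def PolyMobiusTail : Prop :=
  ∀ (k : ℕ) (f : Fin k → Polynomial ℤ), Literature.NumberTheory.Sieve.IsBatemanHornSystem f → ∃ η : ℝ, 0 < η ∧ η < 1 ∧ (fun x : ℕ => ∑ n ∈ Finset.Icc 1 x, ∑ d ∈ Fintype.piFinset (fun i => (((f i).eval (n : ℤ)).toNat).divisors), if (x : ℝ) ^ (1 - η) < ∏ i, (d i : ℝ) then ∏ i, ((ArithmeticFunction.moebius (d i) : ℝ) * Real.log (d i)) else 0) =o[Filter.atTop] fun x : ℕ => (x : ℝ)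

/-- item stmt-Parity-9414 · crux · rank 2 · open · by planner
why it might fail: Hooley1964 saves only (log x)^-δ for deg ≥ 3, no level; e(hν/n) is a Hilbert-modular phase over ℚ(√2) only at an 𝔫-dependent frequency ≍ √n (ν ∈ ℤ is a half-dimensional slice of ℤ[√2]/𝔫): Kuznetsov over F would need uniformity in frequencies up to √(modulus).
sources: DukeFriedlanderIwaniec1995, Hooley1964, doi:10.1093/imrn/rnr112, arXiv:2505.00493, HeathBrown2001LargestPrimeFactorCubic, arXiv:1003.0559
[crux] DFI Proposition 1 transposed to X⁴+1 (the Type-I half of X): for every h ≠ 0 and ε > 0 there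
are δ, C > 0 such that for x ≥ 2 and every cut-off function y with y(d) ≤ x/d: Σ_{d ≤ x^{1/2−ε}}
|Σ_{m ≤ y(d)} ρ_h(dm)| ≤ C x^{1−δ}, ρ_h(n) = Σ_{ν mod n, ν⁴≡−1} e(hν/n) — power-saving
equidistribution of the roots of X⁴+1 modulo n ≡ 0 (mod d) at level x^{1/2−ε} (trivial ≍ x,
heuristic x^{3/4}; numerics j000079 (C): T(x) ≈ x^{0.59} for x ≤ 10⁶). The engine's first
deliverable: over F the sum runs over primitive ideals 𝔫 ≡ 0 (mod 𝔮) of ℤ[√2] and roots of Y² − √2Y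
+ 1. [difficulty: open-problem] -/
@[route_item "route-Parity-CyclotomicTower"]
def QuarticTypeI : Prop :=
  ∀ h : ℤ, h ≠ 0 → ∀ ε : ℝ, 0 < ε → ∃ δ : ℝ, 0 < δ ∧ ∃ C : ℝ, ∀ x : ℝ, 2 ≤ x → ∀ y : ℕ → ℕ, (∀ d : ℕ, (y d : ℝ) ≤ x / d) → ∑ d ∈ Finset.Icc 1 ⌊x ^ (1 / 2 - ε)⌋₊, ‖∑ m ∈ Finset.Icc 1 (y d), ∑ ν ∈ (Finset.range (d * m)).filter (fun ν : ℕ => d * m ∣ ν ^ 4 + 1), Complex.exp (2 * Real.pi * Complex.I * (h * ν / (d * m) : ℂ))‖ ≤ C * x ^ (1 - δ)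

/-- item stmt-Parity-9415 · crux · rank 3 · open · by planner
why it might fail: Even for n²+1 a power saving in the balanced range N ≈ M is not in print (DFI 1995 Prop. 2: short N, β on primes; GM 2025 Thm 1.5: N ≤ X^1/4); the CRT reduction needs QuarticTypeI uniform in d ≤ x^(1−ε) and in twisted frequencies h(n₂−n₁) ≤ x.
sources: DukeFriedlanderIwaniec1995, arXiv:2505.00493, arXiv:1502.00769, KowalskiSoundararajan2021
[crux] DFI Proposition 2 transposed to X⁴+1, in the balanced range (the Type-II half of X): for
every h ≠ 0 and δ > 0 there are η, C > 0 such that for 1 ≤ N, M^δ ≤ N ≤ M and all 1-bounded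
coefficients α, β: |Σ_{M<m≤2M} Σ_{N<n≤2N} α_m β_n ρ_h(mn)| ≤ C (MN)^{1−η}. By CRT ρ_h(mn) =
Σ_{ν₁,ν₂} e(hν₁n̄/m) e(hν₂m̄/n) for (m,n) = 1: bilinear forms with root-weighted Kloosterman
fractions; DFI 1995 p.425 call ‖α‖‖β‖(M+N)^{1/2}(hMN)^ε 'plausible' and prove a shorter range with β
on primes. [deps: QuarticTypeI] [difficulty: open-problem] -/
@[route_item "route-Parity-CyclotomicTower"]
def QuarticTypeII : Prop :=
  ∀ h : ℤ, h ≠ 0 → ∀ δ : ℝ, 0 < δ → ∃ η : ℝ, 0 < η ∧ ∃ C : ℝ, ∀ M N : ℝ, 1 ≤ N → M ^ δ ≤ N → N ≤ M → ∀ α β : ℕ → ℂ, (∀ m, ‖α m‖ ≤ 1) → (∀ n, ‖β n‖ ≤ 1) → ‖∑ m ∈ Finset.Ioc ⌊M⌋₊ ⌊2 * M⌋₊, ∑ n ∈ Finset.Ioc ⌊N⌋₊ ⌊2 * N⌋₊, α m * β n * ∑ ν ∈ (Finset.range (m * n)).filter (fun ν : ℕ => m * n ∣ ν ^ 4 + 1),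 Complex.exp (2 * Real.pi * Complex.I * (h * ν / (m * n) : ℂ))‖ ≤ C * (M * N) ^ (1 - η)

/-- item stmt-Parity-9416 · crux · rank 4 · open · by planner
why it might fail: Needs Weyl sums uniform in h ≤ P/X ≈ X^δ, where the reciprocity error O(h·p^-1/2) bites, plus Type II to reach primes; for n⁴+1 only geometry of numbers goes beyond X (P⁺ ≥ X^(1+c) on a positive density, Delabreteche2015 Thm 1.2; Φ₁₂: c = 10^-26531) — never prime moduli.
sources: doi:10.4064/aa169-3-2, arXiv:2505.00493, HeathBrown2001LargestPrimeFactorCubic, DeshouillersIwaniec1982, MarklofWelsh2023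
[crux] card C2/C4, the consumable rung: there are δ, C > 0 such that for 2 ≤ X ≤ P ≤ X^{1+δ}:
|Σ_{P<p≤2P prime} (#{1 ≤ ℓ ≤ X : p ∣ ℓ⁴+1} − X·ϱ(p)/p)| ≤ C X^{1−δ}, ϱ(p) = #{ν mod p : ν⁴ ≡ −1}
(main term ≍ X/log X, fluctuation heuristic √X; numerics j000079 (B): within 2√main up to P =
X^{1.5}, X ≤ 10⁵). Equidistribution of ν/p at the shrinking scale X/P over PRIME moduli just beyond
X: the prime slice d = p ∈ (x, x^{1+δ}] of the Möbius tail of n⁴+1 (μ(p) = −1 constant ⇒ unsigned)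
and the Dickman-type law for P⁺(n⁴+1) near exponent 1. [deps: QuarticTypeI, QuarticTypeII]
[difficulty: open-problem] -/
@[route_item "route-Parity-CyclotomicTower"]
def QuarticPrimeWindow : Prop :=
  ∃ δ : ℝ, 0 < δ ∧ ∃ C : ℝ, ∀ X P : ℝ, 2 ≤ X → X ≤ P → P ≤ X ^ (1 + δ) → |∑ p ∈ (Finset.Ioc ⌊P⌋₊ ⌊2 * P⌋₊).filter Nat.Prime, ((((Finset.Icc 1 ⌊X⌋₊).filter (fun ℓ : ℕ => p ∣ ℓ ^ 4 + 1)).card : ℝ) - X * (((Finset.range p).filter (fun ν : ℕ => p ∣ ν ^ 4 + 1)).card : ℝ) / p)| ≤ C * X ^ (1 - δ)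

/-- item stmt-Parity-9417 · crux · rank 5 · open · by planner
why it might fail: DFI 1995 p.425: 'the problem for polynomials of higher degree seems to us to be very far away'; for deg ≥ 3 even the density of {ν/p} is known only under Bunyakovsky (Foo2010); = the Kowalski–Soundararajan prime-moduli conjecture at f = X⁴+1.
sources: DukeFriedlanderIwaniec1995, doi:10.4064/aa144-1-1, arXiv:2003.12965, Hooley1964, Toth2000
[crux] card C1, the landmark (implied by QuarticTypeI ∧ QuarticTypeII via VaughanGlue — support
DFIReduction): for every integer h ≠ 0, Σ_{p ≤ P prime} Σ_{ν mod p, ν⁴ ≡ −1} e(hν/p) = o(P/log P)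
(Weyl's criterion for the pairs (p, ν), whose number is ∼ π(P)). Degree-4 instance of DFI 1995; the
prime-modulus input for d = p > x in the X⁴+1 slice of the frame. [deps: QuarticTypeI,
QuarticTypeII] [difficulty: open-problem] -/
@[route_item "route-Parity-CyclotomicTower"]
def QuarticRootsPrimeModuli : Prop :=
  ∀ h : ℤ, h ≠ 0 → (fun P : ℕ => ∑ p ∈ Nat.primesLE P, ∑ ν ∈ (Finset.range p).filter (fun ν : ℕ => p ∣ ν ^ 4 + 1), Complex.exp (2 * Real.pi * Complex.I * (h * ν / p : ℂ))) =o[Filter.atTop] fun P : ℕ => ((P : ℝ) / Real.log P : ℝ)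

/-- item stmt-Parity-0873 · support · rank 9 · closed · proved by Summit.Parity.BatemanHorn.Theorems.typeIMainTerm_proof (prover) · by planner
sources: BatemanHorn1962, BombieriAsymptoticSieve1976
[support] Type-I main term, theorem-grade: for every BH system f and η ∈ (0,1) there is C with
HasBatemanHornConst f C and (−1)^k ∑_{n≤x} ∑_{d_i | f_i(n), d_1⋯d_k ≤ x^{1−η}} ∏ μ(d_i) log d_i ~
C·x. Proof sketch: #{n ≤ x : d_i | f_i(n) ∀ i} = x ρ(d)/lcm(d) + O(ρ(d)) (period lcm(d) ≤ x^{1−η});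
the log-weighted singular series (−1)^k ∑_d ∏(μ(d_i) log d_i) ρ(d)/lcm(d) converges (ordered by the
cutoff) to the Bateman–Horn constant C(f) = ∏_p (1−1/p)^{−k}(1−ω(p)/p) by the prime ideal theorem
with error term in the splitting fields (Landau1903; BatemanHorn1962 §2; DavenportSchinzel1966; k =
1, f = X: −∑ μ(d) log d/d = 1). Named fact available:
Literature.NumberTheory.Sieve.exists_hasBatemanHornConst. Provable with substantial effort;
grounders may propose the needed Dedekind-zeta facts as Literature cites. -/
@[route_item "route-Parity-CyclotomicTower", crux]
def TypeIMainTerm : Prop :=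
  ∀ (k : ℕ) (f : Fin k → Polynomial ℤ), Literature.NumberTheory.Sieve.IsBatemanHornSystem f → ∀ η : ℝ, 0 < η → η < 1 → ∃ C : ℝ, 0 < C ∧ Literature.NumberTheory.Sieve.HasBatemanHornConst f C ∧ Asymptotics.IsEquivalent Filter.atTop (fun x : ℕ => (-1 : ℝ) ^ k * ∑ n ∈ Finset.Icc 1 x, ∑ d ∈ Fintype.piFinset (fun i => (((f i).eval (n : ℤ)).toNat).divisors), if ∏ i, (d i : ℝ) ≤ (x : ℝ) ^ (1 - η) then ∏ i, ((ArithmeticFunction.moebius (d i) : ℝ) * Real.log (d i)) else 0) (fun x : ℕ => C * (x : ℝ))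

/-- item stmt-Parity-0874 · support · rank 9 · closed · proved by Summit.Parity.BatemanHorn.LambdaToCount.lambdaToCount_proof (prover) · by planner
sources: BatemanHorn1962, IwaniecKowalski2004
[support] From Λ-weights to the count, theorem-grade: if ∑_{n≤x} ∏_i Λ(f_i(n)) ~ C·x with
HasBatemanHornConst f C then BatemanHornAsymptotic f (polyPrimeCount f x ~ C/(∏ deg f_i) · x/(log
x)^k). Partial summation (Λ(f_i(n)) = log f_i(n) = deg f_i · log n + O(1) at prime values) plus
negligibility of proper prime-power values f_i(n) = p^a, a ≥ 2: O(x^{1/2+ε}) — trivial for deg ≤ 2,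
Bombieri–Pila / Siegel integral points on y^a = f_i(x) for deg ≥ 3. C > 0 by
Literature.NumberTheory.Sieve.exists_hasBatemanHornConst. -/
@[route_item "route-Parity-CyclotomicTower", crux]
def LambdaToCount : Prop :=
  ∀ (k : ℕ) (f : Fin k → Polynomial ℤ), Literature.NumberTheory.Sieve.IsBatemanHornSystem f → ∀ C : ℝ, 0 < C → Literature.NumberTheory.Sieve.HasBatemanHornConst f C → Asymptotics.IsEquivalent Filter.atTop (fun x : ℕ => ∑ n ∈ Finset.Icc 1 x, ∏ i, ArithmeticFunction.vonMangoldt (((f i).eval (n : ℤ)).toNat)) (fun x : ℕ => C * (x : ℝ)) → Literature.NumberTheory.Sieve.BatemanHornAsymptotic f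

/-- item stmt-Parity-0875 · support · rank 9 · open · by planner
sources: BombieriAsymptoticSieve1976, BatemanHorn1962
[assembly] PolyMobiusTail → TypeIMainTerm → LambdaToCount → BatemanHorn. Given k, f,
IsBatemanHornSystem f: take η from PolyMobiusTail; ∏_i Λ(f_i(n)) = (−1)^k ∑_{d ∈ ∏ divisors(f_i(n))}
∏_i μ(d_i) log d_i (Mathlib ArithmeticFunction.sum_moebius_mul_log_eq per coordinate,
Finset.prod_sum); split at ∏ d_i ≤ x^{1−η} (TypeIMainTerm: ~ C x) vs > x^{1−η} (tail: o(x));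
IsEquivalent.add_isLittleO gives ∑∏Λ ~ C x (C ≠ 0 via
Literature.NumberTheory.Sieve.exists_hasBatemanHornConst or directly); LambdaToCount concludes
BatemanHornAsymptotic f; BatemanHorn := Literature.NumberTheory.Sieve.BatemanHornConjecture is ∀ k
f, IsBatemanHornSystem f → BatemanHornAsymptotic f. Provable now (bookkeeping only). -/
@[route_item "route-Parity-CyclotomicTower"]
def MobiusFrame : Prop :=
  PolyMobiusTail → TypeIMainTerm → LambdaToCount → _root_.BatemanHorn

/-- item stmt-Parity-9418 · support · rank 9 · open · by planner
sources: Vaughan1980, IwaniecKowalski2004, DukeFriedlanderIwaniec1995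
[support] sequence-agnostic glue (known method, provable with effort): for c : ℕ → ℂ with |c(n)| ≤
τ(n)², Type I at level x^{1/2−ε} with a power saving (sup-over-length form) and Type II with a power
saving whenever M^δ ≤ N ≤ M imply Σ_{p≤P} c(p) = o(P/log P). Proof: Vaughan's identity with U = V =
P^{δ₀} (in tree: Literature.NumberTheory.Sieve.VaughanMeanValueDecomposition,
vonMangoldt_eq_four_terms), Type I pieces by partial summation (level P^{2δ₀} ≤ P^{1/2−ε}), Type II
pieces after dyadic decomposition and Perron separation of mn ≤ P (twists m^{it}, n^{it} keep
coefficients 1-bounded), τ-bounds ≤ P^ε against the power saving, prime powers trivially, partial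
summation from Λ to primes. [difficulty: L] -/
@[route_item "route-Parity-CyclotomicTower"]
def VaughanGlue : Prop :=
  ∀ c : ℕ → ℂ, (∀ n : ℕ, ‖c n‖ ≤ ((Nat.divisors n).card : ℝ) ^ 2) → (∀ ε : ℝ, 0 < ε → ∃ δ : ℝ, 0 < δ ∧ ∃ C : ℝ, ∀ x : ℝ, 2 ≤ x → ∀ y : ℕ → ℕ, (∀ d : ℕ, (y d : ℝ) ≤ x / d) → ∑ d ∈ Finset.Icc 1 ⌊x ^ (1 / 2 - ε)⌋₊, ‖∑ m ∈ Finset.Icc 1 (y d), c (d * m)‖ ≤ C * x ^ (1 - δ)) → (∀ δ : ℝ, 0 < δ → ∃ η : ℝ, 0 < η ∧ ∃ C : ℝ, ∀ M N : ℝ, 1 ≤ N → M ^ δ ≤ N → N ≤ M → ∀ α β : ℕ → ℂ, (∀ m, ‖α m‖ ≤ 1) → (∀ n, ‖β n‖ ≤ 1) → ‖∑ m ∈ Finset.Ioc ⌊M⌋₊ ⌊2 * M⌋₊, ∑ n ∈ Finset.Ioc ⌊N⌋₊ ⌊2 * N⌋₊, α m * β n * c (m * n)‖ ≤ C * (M *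 N) ^ (1 - η)) → (fun P : ℕ => ∑ p ∈ Nat.primesLE P, c p) =o[Filter.atTop] fun P : ℕ => ((P : ℝ) / Real.log P : ℝ)

/-- item stmt-Parity-9419 · support · rank 9 · open · by planner
sources: doi:10.4064/aa169-3-2, Toth2000
[support] the dictionary lemma at primes: in 𝔽_p with s² = 2, ν⁴ + 1 = 0 ↔ (ν² − sν + 1 = 0 ∨ ν² +
sν + 1 = 0), from X⁴+1 = (X² − sX + 1)(X² + sX + 1); i.e. the roots of X⁴+1 mod p ≡ ±1 (8) are the
roots of the CM relative quadratic g = Y² − √2·Y + 1 of ℚ(ζ₈)/ℚ(√2) read at the two degree-one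
primes of ℤ[√2] above p (√2 ↦ ±s). Provable now (ring identity + no zero divisors). [difficulty:
provable-now] -/
@[route_item "route-Parity-CyclotomicTower"]
def TowerSplitting : Prop :=
  ∀ (p : ℕ) [Fact p.Prime] (s ν : ZMod p), s ^ 2 = 2 → (ν ^ 4 + 1 = 0 ↔ ν ^ 2 - s * ν + 1 = 0 ∨ ν ^ 2 + s * ν + 1 = 0)

/-- item stmt-Parity-9420 · support · rank 9 · open · by planner
sources: DukeFriedlanderIwaniec1995, Toth2000
[support] the card's reciprocity step as an exact identity: for ε = ±1, p = ε(c² − 2d²) > 0, d ≠ 0,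
gcd(c, d) = 1, p ∣ dν − (dA₀ − cA₁) (i.e. ν ≡ A₀ + A₁√2 with √2 ≡ −c/d mod p) and c·c̄ ≡ 1 (mod d):
ν/p ≡ A₀/p + ε·A₁·c̄/d − A₁c/(dp) (mod 1). With c + d√2 in a fixed fundamental domain for the unit
1+√2 (|c|, |d| ≍ √p) and a short representative |Aᵢ| ≪ √p this is ν/p = εA₁c̄/d + O(p^{−1/2}): a
Kloosterman fraction of modulus d ≍ √p (DFI, n²+1: ν/p = −s̄/r + O(1/p)). Checked numerically
in-session (p = 17 = 5²−2·2², ν = 8, A = 2+√2; p = 7, ε = −1). Provable now (two-term reciprocity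
d̄/p + p̄/d ≡ 1/(dp), p ≡ εc² mod d). [difficulty: provable-now] -/
@[route_item "route-Parity-CyclotomicTower"]
def RootReciprocity : Prop :=
  ∀ (ε c d A₀ A₁ ν cbar : ℤ) (p : ℕ), (ε = 1 ∨ ε = -1) → (p : ℤ) = ε * (c ^ 2 - 2 * d ^ 2) → 0 < p → d ≠ 0 → IsCoprime c d → (p : ℤ) ∣ d * ν - (d * A₀ - c * A₁) → c * cbar ≡ 1 [ZMOD d] → ∃ k : ℤ, (ν : ℝ) / p = k + A₀ / p + ε * A₁ * cbar / d - A₁ * c / (d * p)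

/-- item stmt-Parity-9421 · support · rank 9 · open · by planner
sources: DukeFriedlanderIwaniec1995, Vaughan1980
[support] the DFI architecture as a provable implication (the retired route's assembly):
QuarticTypeI → QuarticTypeII → VaughanGlue → QuarticRootsPrimeModuli — fix h ≠ 0 and apply
VaughanGlue to c := ρ_h, using |ρ_h(n)| ≤ ϱ(n) ≤ 4^{ω(n)} ≤ τ(n)² (X⁴+1 has ≤ 4 simple roots mod p^a
for odd p, ϱ(2) = 1, ϱ(4) = 0) and the cast ((d·m : ℕ) : ℂ) = d·m. Provable now. [difficulty:
provable-now] -/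
@[route_item "route-Parity-CyclotomicTower"]
def DFIReduction : Prop :=
  QuarticTypeI → QuarticTypeII → VaughanGlue → QuarticRootsPrimeModuli

/-- item stmt-Parity-9422 · assembly · rank 1 · open · by planner
sources: BombieriAsymptoticSieve1976, DukeFriedlanderIwaniec1995
[assembly] QuarticTypeI → QuarticTypeII → QuarticPrimeWindow → QuarticRootsPrimeModuli →
PolyMobiusTail → TypeIMainTerm → LambdaToCount → MobiusFrame → _root_.BatemanHorn (provable now:
`fun _ _ _ _ hT hM hL hF => hF hT hM hL`). -/
@[route_item "route-Parity-CyclotomicTower"]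
def Assembly : Prop :=
  QuarticTypeI → QuarticTypeII → QuarticPrimeWindow → QuarticRootsPrimeModuli → PolyMobiusTail → TypeIMainTerm → LambdaToCount → MobiusFrame → _root_.BatemanHorn

/-! D-0027 §2.1 — DECIDING THEOREM (planner-authored via `route open/edit --closes-file`; by planner-rrepair-Parity-CyclotomicTower-01aa0f64-g2-0 2026-08-15T17:02:11Z):
its hypotheses are this route's items and its conclusion the sub-problem Statement (glue_lint), and it elaborates with this file. -/

/-- D-0027 §2.1 deciding theorem of route CyclotomicTower: the three load-bearing frame items
`PolyMobiusTail` (target, = X_PM of route PolynomialMobius), `TypeIMainTerm` and `LambdaToCount`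
(theorem-grade support) imply the sub-problem statement `BatemanHorn`
(= `Literature.NumberTheory.Sieve.BatemanHornConjecture`). Same bookkeeping proof as
PolynomialMobius.closes (the three decls are verbatim the shared items stmt-Parity-0870/0873/0874):
`∏ᵢ Λ(fᵢ(n)) = (−1)^k ∑_{dᵢ ∣ fᵢ(n)} ∏ᵢ μ(dᵢ) log dᵢ` (Mathlib `ArithmeticFunction.sum_moebius_mul_log_eq`
per coordinate, `Finset.prod_neg`, `Finset.prod_univ_sum`), the split of the divisor sum at
`∏ dᵢ ≤ x^{1−η}` versus `x^{1−η} < ∏ dᵢ`, then `IsEquivalent.add_isLittleO` and `LambdaToCount`.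
The quartic cruxes (QuarticTypeI/II, QuarticPrimeWindow, QuarticRootsPrimeModuli) feed the k = 1,
f = X⁴+1 prime-modulus slice of `PolyMobiusTail` (prose link in the thesis); they are not hypotheses here. -/
@[closes "route-Parity-CyclotomicTower"] theorem closes (hTail : PolyMobiusTail) (hMain : TypeIMainTerm) (hCount : LambdaToCount) :
    _root_.BatemanHorn := by
  intro k f hf
  obtain ⟨η, hη0, hη1, hT⟩ := hTail k f hf
  obtain ⟨C, hC, hHas, hM⟩ := hMain k f hf η hη0 hη1
  refine hCount k f hf C hC hHas ?_
  -- Λ = -(μ · log) ∗ 1, coordinatewise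
  have hΛ : ∀ m : ℕ, ArithmeticFunction.vonMangoldt m
      = -∑ e ∈ m.divisors, ((ArithmeticFunction.moebius e : ℝ) * Real.log e) := by
    intro m
    have h := ArithmeticFunction.sum_moebius_mul_log_eq (n := m)
    simp only [ArithmeticFunction.log_apply] at h
    linarith
  -- step A: the product of the `Λ(fᵢ(n))` as a signed sum over divisor tuples
  have stepA : ∀ n : ℕ, (∏ i, ArithmeticFunction.vonMangoldt (((f i).eval (n : ℤ)).toNat))
      = (-1 : ℝ) ^ k * ∑ d ∈ Fintype.piFinset (fun i => (((f i).eval (n : ℤ)).toNat).divisors),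
          ∏ i, ((ArithmeticFunction.moebius (d i) : ℝ) * Real.log (d i)) := by
    intro n
    simp_rw [hΛ]
    rw [Finset.prod_neg, Finset.card_univ, Fintype.card_fin, Finset.prod_univ_sum]
  -- step B: the divisor sum splits into the Type-I range and the tail (complementary cut-offs)
  have stepB : ∀ x n : ℕ,
      (∑ d ∈ Fintype.piFinset (fun i => (((f i).eval (n : ℤ)).toNat).divisors),
          ∏ i, ((ArithmeticFunction.moebius (d i) : ℝ) * Real.log (d i)))
      = (∑ d ∈ Fintype.piFinset (fun i => (((f i).eval (n : ℤ)).toNat).divisors),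
          if ∏ i, (d i : ℝ) ≤ (x : ℝ) ^ (1 - η) then
            ∏ i, ((ArithmeticFunction.moebius (d i) : ℝ) * Real.log (d i)) else 0)
        + (∑ d ∈ Fintype.piFinset (fun i => (((f i).eval (n : ℤ)).toNat).divisors),
          if (x : ℝ) ^ (1 - η) < ∏ i, (d i : ℝ) then
            ∏ i, ((ArithmeticFunction.moebius (d i) : ℝ) * Real.log (d i)) else 0) := by
    intro x n
    rw [← Finset.sum_add_distrib]
    refine Finset.sum_congr rfl fun d _ => ?_
    by_cases h : ∏ i, (d i : ℝ) ≤ (x : ℝ) ^ (1 - η)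
    · rw [if_pos h, if_neg (not_lt.mpr h), add_zero]
    · rw [if_neg h, if_pos (not_le.mp h), zero_add]
  -- the tail, times `(-1)^k`, is `o(C·x)`
  have hB := (hT.const_mul_left ((-1 : ℝ) ^ k)).trans_isBigO
    (Asymptotics.isBigO_self_const_mul hC.ne' (fun x : ℕ => (x : ℝ)) Filter.atTop)
  refine (hM.add_isLittleO hB).congr_left (Filter.Eventually.of_forall fun x => ?_)
  simp only [Pi.add_apply]
  rw [← mul_add, ← Finset.sum_add_distrib, Finset.mul_sum]
  refine Finset.sum_congr rfl fun n _ => ?_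
  rw [stepA n, stepB x n]

end Summit.Parity.BatemanHorn.Theses.CyclotomicTower
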